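import Mathlib
import Literature.NumberTheory.Transcendental.KZHomotopyMoves
import Literature.NumberTheory.Transcendental.KZSemialgebraicComplex
import Literature.NumberTheory.Transcendental.KZProductIdeal
import Literature.NumberTheory.Transcendental.KZLogCalculusProofs
import Literature.NumberTheory.Transcendental.KZCalculusProofs
import Literature.NumberTheory.Transcendental.KZIntervalPeriodProofs
import Literature.NumberTheory.Transcendental.SemialgebraicMapsProofs
import HarnessLib
import HarnessLib.Audit

/-!
# The dual Riemann relations are theorems of the calculus, I: the kit (solo-informed, s36)

Analysis and semialgebraic geometry of the fibre primitive
`A(x₁,x₂) = f(x₂)/((x₁−x₂)Y(x₁)Y(x₂))`, `Y = √|f|`, of the dual Riemann kernel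
`Θ = T/(Y(x₁)Y(x₂))`, `T = [(f(x₁)−f(x₂))/(x₁−x₂) − ½(f'(x₁)+f'(x₂))]/(x₁−x₂)` (the Casimir
kernel, coefficient matrix `−2S⁻¹`), for `f ∈ ℚ[x]`:

* `u/√|u|` is continuous and has derivative `u'/(2√|u|)` off `u = 0`
  (`soloInformedDR_continuous_div_sqrt_abs`, `soloInformedDR_hasDerivAt_div_sqrt_abs`);
* the real Stokes identity `Θ = (∂A)∘swap − ∂A` off the diagonal (`soloInformedDR_theta_eq`);
* fibrewise continuity of `A(p,·)` on closed fibres avoiding `p` and its fibre derivative `∂A`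
  (`soloInformedDR_prim_continuousOn`, `soloInformedDR_prim_hasDerivAt`);
* `ℚ`-semialgebraicity of `A` and `∂A` off the diagonal (`soloInformedDR_sa_prim_der`);
* domination on `ℝ²` by products of one-variable integrable functions and the bound
  `|∂A| ≤ M·Y(x₁)⁻¹Y(x₂)⁻¹` away from the diagonal (`soloInformedDR_integrableOn_of_le`,
  `soloInformedDR_der_bound`).

File II (`SoloInformedDualRiemann`) assembles THEOREM XXVII-K from these.

References: M. Kontsevich, D. Zagier, *Periods* (2001), §1.2; this work (solo-informed s36).
-/

noncomputable section

open MeasureTheory Set Filter Topology Polynomial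
open scoped Classical

open Literature.NumberTheory.Transcendental Literature.NumberTheory.Transcendental.KZ
open Literature.ModelTheory.ExponentialFields

namespace Summit.KontsevichZagierPeriods.KontsevichZagierPeriods.Theorems

/-! ### One-variable analysis of `u/√|u|` -/

/-- `|u/√|u|| ≤ √|u|`. [folklore] -/
theorem soloInformedDR_abs_div_sqrt_abs_le (x : ℝ) : abs (x / √|x|) ≤ √|x| := by
  by_cases h : x = 0
  · simp [h]
  · rw [abs_div, abs_of_nonneg (Real.sqrt_nonneg _),
      div_le_iff₀ (Real.sqrt_pos.2 (abs_pos.2 h)), Real.mul_self_sqrt (abs_nonneg _)]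

/-- `t ↦ u(t)/√|u(t)|` is continuous for continuous `u` (it is `sign(u)√|u|`). [folklore] -/
theorem soloInformedDR_continuous_div_sqrt_abs {u : ℝ → ℝ} (hu : Continuous u) :
    Continuous fun t => u t / √|u t| := by
  rw [continuous_iff_continuousAt]
  intro t
  by_cases h : u t = 0
  · have h1 : Tendsto (fun s => √|u s|) (𝓝 t) (𝓝 0) := by
      have := ((hu.abs).sqrt).continuousAt (x := t)
      simpa [ContinuousAt, h] using this
    have h2 : Tendsto (fun s => u s / √|u s|) (𝓝 t) (𝓝 0) :=
      squeeze_zero_norm (fun s => by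
        simpa only [Real.norm_eq_abs] using soloInformedDR_abs_div_sqrt_abs_le (u s)) h1
    simpa [ContinuousAt, h] using h2
  · exact hu.continuousAt.div ((hu.abs).sqrt).continuousAt
      (Real.sqrt_ne_zero'.2 (abs_pos.2 h))

/-- Where `u ≠ 0`, `u/√|u|` has derivative `u'/(2√|u|)`. [folklore] -/
theorem soloInformedDR_hasDerivAt_div_sqrt_abs {u : ℝ → ℝ} {u' t : ℝ} (hu : HasDerivAt u u' t)
    (ht : u t ≠ 0) : HasDerivAt (fun s => u s / √|u s|) (u' / (2 * √|u t|)) t := by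
  rcases lt_or_gt_of_ne ht with hneg | hpos
  · have hev : ∀ᶠ s in 𝓝 t, u s < 0 := hu.continuousAt.eventually (gt_mem_nhds hneg)
    have hnt : 0 < -u t := by linarith
    have h1 : HasDerivAt (fun s => -√(-u s)) (-(-u' / (2 * √(-u t)))) t :=
      (hu.neg.sqrt hnt.ne').neg
    have h2 : (fun s => u s / √|u s|) =ᶠ[𝓝 t] fun s => -√(-u s) := by
      filter_upwards [hev] with s hs
      have hs' : 0 < -u s := by linarith
      rw [abs_of_neg hs, div_eq_iff (Real.sqrt_pos.2 hs').ne', neg_mul,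
        Real.mul_self_sqrt hs'.le, neg_neg]
    refine (h1.congr_of_eventuallyEq h2).congr_deriv ?_
    rw [abs_of_neg hneg]; ring
  · have hev : ∀ᶠ s in 𝓝 t, 0 < u s := hu.continuousAt.eventually (lt_mem_nhds hpos)
    have h1 : HasDerivAt (fun s => √(u s)) (u' / (2 * √(u t))) t := hu.sqrt hpos.ne'
    have h2 : (fun s => u s / √|u s|) =ᶠ[𝓝 t] fun s => √(u s) := by
      filter_upwards [hev] with s hs
      rw [abs_of_pos hs, Real.div_sqrt]
    refine (h1.congr_of_eventuallyEq h2).congr_deriv ?_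
    rw [abs_of_pos hpos]

/-! ### The kernel, the primitive and its fibre derivative -/

/-- `Y_f(x) = √|f(x)|`. [this work] -/
def soloInformedDRY (f : ℚ[X]) (x : ℝ) : ℝ := √|aeval x f|

/-- The fibre primitive `A(x₁,x₂) = f(x₂)/((x₁−x₂)Y(x₁)Y(x₂))` (coordinates `x₁ = w 0`,
`x₂ = w 1`). [this work] -/
def soloInformedDRPrim (f : ℚ[X]) (w : Fin 2 → ℝ) : ℝ :=
  aeval (w 1) f / ((w 0 - w 1) * soloInformedDRY f (w 0) * soloInformedDRY f (w 1))

/-- `∂A/∂x₂ = [½ f'(x₂)(x₁−x₂) + f(x₂)]/((x₁−x₂)² Y(x₁) Y(x₂))`. [this work] -/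
def soloInformedDRDer (f : ℚ[X]) (w : Fin 2 → ℝ) : ℝ :=
  (aeval (w 1) (derivative f) / 2 * (w 0 - w 1) + aeval (w 1) f) /
    ((w 0 - w 1) ^ 2 * soloInformedDRY f (w 0) * soloInformedDRY f (w 1))

/-- The dual Riemann kernel `Θ = T/(Y₁Y₂)`,
`T = [(f(x₁)−f(x₂))/(x₁−x₂) − ½(f'(x₁)+f'(x₂))]/(x₁−x₂)`. [this work] -/
def soloInformedDRTheta (f : ℚ[X]) (w : Fin 2 → ℝ) : ℝ :=
  ((aeval (w 0) f - aeval (w 1) f) / (w 0 - w 1) -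
      (aeval (w 0) (derivative f) + aeval (w 1) (derivative f)) / 2) /
    ((w 0 - w 1) * soloInformedDRY f (w 0) * soloInformedDRY f (w 1))

/-- The real Stokes identity `Θ(x₁,x₂) = (∂A)(x₂,x₁) − (∂A)(x₁,x₂)` on the open rectangle.
[this work] -/
theorem soloInformedDR_theta_eq (f : ℚ[X]) (w : Fin 2 → ℝ) (hne : w 0 ≠ w 1)
    (h0 : aeval (w 0) f ≠ 0) (h1 : aeval (w 1) f ≠ 0) :
    soloInformedDRDer f (fun i => w (Equiv.swap 0 1 i)) - soloInformedDRDer f w =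
      soloInformedDRTheta f w := by
  have hD : w 0 - w 1 ≠ 0 := sub_ne_zero.2 hne
  have hD' : w 1 - w 0 ≠ 0 := sub_ne_zero.2 (Ne.symm hne)
  have hY0 : √|aeval (w 0) f| ≠ 0 := Real.sqrt_ne_zero'.2 (abs_pos.2 h0)
  have hY1 : √|aeval (w 1) f| ≠ 0 := Real.sqrt_ne_zero'.2 (abs_pos.2 h1)
  simp only [soloInformedDRDer, soloInformedDRTheta, soloInformedDRY, Equiv.swap_apply_left,
    Equiv.swap_apply_right]
  field_simp
  ring

/-- A rearrangement of a triple quotient. [folklore] -/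
theorem soloInformedDR_div_mul3 (a D P Q : ℝ) : a / (D * P * Q) = a / Q * (D * P)⁻¹ := by
  rw [← div_eq_mul_inv, div_div, mul_comm Q]

/-- The primitive along a fibre: `A(p,t) = (f(t)/Y(t)) · ((p−t)Y(p))⁻¹`. [this work] -/
theorem soloInformedDR_prim_snoc (f : ℚ[X]) (v : Fin 1 → ℝ) (t : ℝ) :
    soloInformedDRPrim f (Fin.snoc v t) =
      aeval t f / √|aeval t f| * ((v 0 - t) * √|aeval (v 0) f|)⁻¹ := by
  have e0 : (Fin.snoc v t : Fin 2 → ℝ) 0 = v 0 := rfl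
  have e1 : (Fin.snoc v t : Fin 2 → ℝ) 1 = t := rfl
  simp only [soloInformedDRPrim, soloInformedDRY, e0, e1]
  exact soloInformedDR_div_mul3 _ _ _ _

/-- Fibrewise continuity of the primitive on a closed fibre avoiding `x₁`. [this work] -/
theorem soloInformedDR_prim_continuousOn (f : ℚ[X]) (v : Fin 1 → ℝ) {K : Set ℝ}
    (hK : ∀ t ∈ K, v 0 ≠ t) (hv : aeval (v 0) f ≠ 0) :
    ContinuousOn (fun t : ℝ => soloInformedDRPrim f (Fin.snoc v t)) K := by
  have hY0 : √|aeval (v 0) f| ≠ 0 := Real.sqrt_ne_zero'.2 (abs_pos.2 hv)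
  have h1 : Continuous fun t : ℝ => aeval t f / √|aeval t f| :=
    soloInformedDR_continuous_div_sqrt_abs (Polynomial.continuous_aeval f)
  have h2 : ContinuousOn (fun t : ℝ => ((v 0 - t) * √|aeval (v 0) f|)⁻¹) K :=
    ContinuousOn.inv₀ ((continuous_const.sub continuous_id).mul continuous_const).continuousOn
      fun t ht => mul_ne_zero (sub_ne_zero.2 (hK t ht)) hY0
  refine (h1.continuousOn.mul h2).congr fun t _ => ?_
  exact soloInformedDR_prim_snoc f v t

/-- Fibrewise derivative of the primitive: `∂ₜ A(p,t) = (∂A)(p,t)` where `f(t) ≠ 0`, `t ≠ p`.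
[this work] -/
theorem soloInformedDR_prim_hasDerivAt (f : ℚ[X]) (v : Fin 1 → ℝ) {t : ℝ} (hpt : v 0 ≠ t)
    (hv : aeval (v 0) f ≠ 0) (ht : aeval t f ≠ 0) :
    HasDerivAt (fun s : ℝ => soloInformedDRPrim f (Fin.snoc v s))
      (soloInformedDRDer f (Fin.snoc v t)) t := by
  have hY0 : √|aeval (v 0) f| ≠ 0 := Real.sqrt_ne_zero'.2 (abs_pos.2 hv)
  have hYt : √|aeval t f| ≠ 0 := Real.sqrt_ne_zero'.2 (abs_pos.2 ht)
  have hD : v 0 - t ≠ 0 := sub_ne_zero.2 hpt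
  have h1 : HasDerivAt (fun s : ℝ => aeval s f / √|aeval s f|)
      (aeval t (derivative f) / (2 * √|aeval t f|)) t :=
    soloInformedDR_hasDerivAt_div_sqrt_abs (Polynomial.hasDerivAt_aeval f t) ht
  have h2 : HasDerivAt (fun s : ℝ => (v 0 - s) * √|aeval (v 0) f|) (-1 * √|aeval (v 0) f|) t :=
    ((hasDerivAt_id t).const_sub (v 0)).mul_const _
  have h3 := h1.mul (h2.inv (mul_ne_zero hD hY0))
  have hfun : (fun s : ℝ => soloInformedDRPrim f (Fin.snoc v s)) =
      fun s => aeval s f / √|aeval s f| * ((v 0 - s) * √|aeval (v 0) f|)⁻¹ := by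
    funext s; exact soloInformedDR_prim_snoc f v s
  rw [hfun]
  refine h3.congr_deriv ?_
  have e0 : (Fin.snoc v t : Fin 2 → ℝ) 0 = v 0 := rfl
  have e1 : (Fin.snoc v t : Fin 2 → ℝ) 1 = t := rfl
  simp only [soloInformedDRDer, soloInformedDRY, e0, e1, Pi.inv_apply]
  field_simp

/-! ### Semialgebraicity -/

/-- `w ↦ p(w i)` is `ℚ`-semialgebraic for `p ∈ ℚ[x]`. [folklore] -/
theorem soloInformedDR_sa_aeval {N : ℕ} {S : Set (Fin N → ℝ)} (hS : IsSemialgebraic ℚ S)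
    (i : Fin N) (p : ℚ[X]) : IsSemialgebraicFunOn ℚ S (fun w => aeval (w i) p) := by
  refine (isSemialgebraicFunOn_aeval hS
    (aeval (MvPolynomial.X i : MvPolynomial (Fin N) ℚ) p)).congr fun w _ => ?_
  show MvPolynomial.aeval w (aeval (MvPolynomial.X i : MvPolynomial (Fin N) ℚ) p) = aeval (w i) p
  rw [← Polynomial.aeval_algHom_apply, MvPolynomial.aeval_X]

/-- The zero set `{w | f(w i) = 0}` is `ℚ`-semialgebraic. [folklore] -/
theorem soloInformedDR_sa_zeroSet {N : ℕ} (i : Fin N) (p : ℚ[X]) :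
    IsSemialgebraic ℚ {w : Fin N → ℝ | aeval (w i) p = 0} := by
  have := isSemialgebraic_setOf_eval_eq_zero (k := ℚ) (R := ℝ)
    (aeval (MvPolynomial.X i : MvPolynomial (Fin N) ℚ) p)
  convert this using 1
  ext w
  simp only [mem_setOf_eq]
  rw [← Polynomial.aeval_algHom_apply, MvPolynomial.aeval_X]

/-- The rational open interval `(α, β) ⊆ ℝ¹` is `ℚ`-semialgebraic. [folklore] -/
theorem soloInformedDR_sa_base (α β : ℚ) :
    IsSemialgebraic ℚ {v : Fin 1 → ℝ | (α:ℝ) < v 0 ∧ v 0 < (β:ℝ)} := by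
  have h1 := isSemialgebraic_setOf_eval_pos (k := ℚ) (R := ℝ)
    (MvPolynomial.X 0 - MvPolynomial.C α : MvPolynomial (Fin 1) ℚ)
  have h2 := isSemialgebraic_setOf_eval_pos (k := ℚ) (R := ℝ)
    (MvPolynomial.C β - MvPolynomial.X 0 : MvPolynomial (Fin 1) ℚ)
  convert h1.inter h2 using 1
  ext v
  simp only [mem_setOf_eq, mem_inter_iff, map_sub, MvPolynomial.aeval_X, MvPolynomial.aeval_C,
    eq_ratCast, sub_pos]

/-- **Semialgebraicity of the primitive and of its fibre derivative** on any `ℚ`-semialgebraic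
`S ⊆ ℝ²` off the diagonal on which `f(w 0) ≠ 0` (where `f(w 1) = 0` both functions vanish by
the junk value of division). [this work] -/
theorem soloInformedDR_sa_prim_der {S : Set (Fin 2 → ℝ)} (hS : IsSemialgebraic ℚ S) (f : ℚ[X])
    (h : ∀ w ∈ S, w 0 ≠ w 1 ∧ aeval (w 0) f ≠ 0) :
    IsSemialgebraicFunOn ℚ S (soloInformedDRPrim f) ∧
      IsSemialgebraicFunOn ℚ S (soloInformedDRDer f) := by
  have hZ := soloInformedDR_sa_zeroSet (N := 2) 1 f
  set S₁ : Set (Fin 2 → ℝ) := S \ {w : Fin 2 → ℝ | aeval (w 1) f = 0} with hS₁def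
  set S₂ : Set (Fin 2 → ℝ) := S ∩ {w : Fin 2 → ℝ | aeval (w 1) f = 0} with hS₂def
  have hS₁ : IsSemialgebraic ℚ S₁ := hS.diff hZ
  have hS₂ : IsSemialgebraic ℚ S₂ := hS.inter hZ
  have hSU : S₁ ∪ S₂ = S := sdiff_union_inter S _
  have hne : ∀ w ∈ S₁, w 0 - w 1 ≠ 0 ∧ √|aeval (w 0) f| ≠ 0 ∧ √|aeval (w 1) f| ≠ 0 := by
    intro w hw
    have hw2 : ¬ aeval (w 1) f = 0 := hw.2
    exact ⟨sub_ne_zero.2 (h w hw.1).1, Real.sqrt_ne_zero'.2 (abs_pos.2 (h w hw.1).2),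
      Real.sqrt_ne_zero'.2 (abs_pos.2 hw2)⟩
  have hφ0 := soloInformedDR_sa_aeval hS₁ 0 f
  have hφ1 := soloInformedDR_sa_aeval hS₁ 1 f
  have hφ1' := soloInformedDR_sa_aeval hS₁ 1 (derivative f)
  have hY0 : IsSemialgebraicFunOn ℚ S₁ (fun w => √|aeval (w 0) f|) :=
    IsSemialgebraicFunOn.sqrt_holds hφ0.abs
  have hY1 : IsSemialgebraicFunOn ℚ S₁ (fun w => √|aeval (w 1) f|) :=
    IsSemialgebraicFunOn.sqrt_holds hφ1.abs
  have hD : IsSemialgebraicFunOn ℚ S₁ (fun w => w 0 - w 1) :=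
    (isSemialgebraicFunOn_aeval hS₁
      (MvPolynomial.X 0 - MvPolynomial.X 1 : MvPolynomial (Fin 2) ℚ)).congr fun w _ => by
      simp only [map_sub, MvPolynomial.aeval_X]
  have hD2 : IsSemialgebraicFunOn ℚ S₁ (fun w => (w 0 - w 1) / 2) :=
    (isSemialgebraicFunOn_aeval hS₁ (MvPolynomial.C (1/2:ℚ) *
      (MvPolynomial.X 0 - MvPolynomial.X 1) : MvPolynomial (Fin 2) ℚ)).congr fun w _ => by
      simp only [map_mul, map_sub, MvPolynomial.aeval_X, MvPolynomial.aeval_C, eq_ratCast]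
      push_cast
      ring
  have hden1 : IsSemialgebraicFunOn ℚ S₁
      ((fun w => w 0 - w 1) * (fun w => √|aeval (w 0) f|) * fun w => √|aeval (w 1) f|) :=
    IsSemialgebraicFunOn.mul_holds (IsSemialgebraicFunOn.mul_holds hD hY0) hY1
  have hden2 : IsSemialgebraicFunOn ℚ S₁
      ((fun w => w 0 - w 1) * (fun w => w 0 - w 1) * (fun w => √|aeval (w 0) f|) *
        fun w => √|aeval (w 1) f|) :=
    IsSemialgebraicFunOn.mul_holds
      (IsSemialgebraicFunOn.mul_holds (IsSemialgebraicFunOn.mul_holds hD hD) hY0) hY1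
  have hP₁ : IsSemialgebraicFunOn ℚ S₁ (soloInformedDRPrim f) := by
    refine (hφ1.div hden1 fun w hw => ?_).congr fun w _ => ?_
    · simp only [Pi.mul_apply]
      exact mul_ne_zero (mul_ne_zero (hne w hw).1 (hne w hw).2.1) (hne w hw).2.2
    · simp only [Pi.mul_apply, soloInformedDRPrim, soloInformedDRY]
  have hA₁ : IsSemialgebraicFunOn ℚ S₁ (soloInformedDRDer f) := by
    refine ((IsSemialgebraicFunOn.add_holds (IsSemialgebraicFunOn.mul_holds hφ1' hD2) hφ1).div
      hden2 fun w hw => ?_).congr fun w _ => ?_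
    · simp only [Pi.mul_apply]
      exact mul_ne_zero (mul_ne_zero (mul_ne_zero (hne w hw).1 (hne w hw).1) (hne w hw).2.1)
        (hne w hw).2.2
    · simp only [Pi.mul_apply, Pi.add_apply, soloInformedDRDer, soloInformedDRY]
      congr 1 <;> ring
  have h0₂ : IsSemialgebraicFunOn ℚ S₂ (fun _ => (0:ℝ)) :=
    isSemialgebraicFunOn_const_of_isAlgebraic hS₂ isAlgebraic_zero
  have hP₂ : ∀ w ∈ S₂, soloInformedDRPrim f w = 0 := by
    intro w hw
    have hw2 : aeval (w 1) f = 0 := hw.2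
    simp [soloInformedDRPrim, hw2]
  have hA₂ : ∀ w ∈ S₂, soloInformedDRDer f w = 0 := by
    intro w hw
    have hw2 : aeval (w 1) f = 0 := hw.2
    simp [soloInformedDRDer, soloInformedDRY, hw2]
  refine ⟨?_, ?_⟩
  · have := IsSemialgebraicFunOn.union hP₁ h0₂ (F := soloInformedDRPrim f) (fun w _ => rfl) hP₂
    rwa [hSU] at this
  · have := IsSemialgebraicFunOn.union hA₁ h0₂ (F := soloInformedDRDer f) (fun w _ => rfl) hA₂
    rwa [hSU] at this

/-! ### Integrability: products and domination on `ℝ²` -/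

/-- A product `u₀(w 0)·u₁(w 1)` of integrable functions is integrable on `ℝ²`. [folklore] -/
theorem soloInformedDR_integrable_prod {u₀ u₁ : ℝ → ℝ} (h₀ : Integrable u₀) (h₁ : Integrable u₁) :
    Integrable (fun w : Fin 2 → ℝ => u₀ (w 0) * u₁ (w 1)) := by
  have := MeasureTheory.Integrable.fintype_prod (μ := fun _ : Fin 2 => (volume : Measure ℝ))
    (f := fun i : Fin 2 => if i = 0 then u₀ else u₁) (fun i => by
      fin_cases i
      · simpa using h₀
      · simpa using h₁)
  simpa [Fin.prod_univ_two, MeasureTheory.volume_pi] using this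

/-- **Domination on `ℝ²`.**  A measurable `G` with `|G(w)| ≤ M·u₀(w 0)·u₁(w 1)` on a measurable
`S`, `u₀, u₁` integrable, is absolutely integrable on `S`. [folklore] -/
theorem soloInformedDR_integrableOn_of_le {S : Set (Fin 2 → ℝ)} (hS : MeasurableSet S)
    {G : (Fin 2 → ℝ) → ℝ} (hG : AEStronglyMeasurable G (volume.restrict S))
    {u₀ u₁ : ℝ → ℝ} (h₀ : Integrable u₀) (h₁ : Integrable u₁) (M : ℝ)
    (hle : ∀ w ∈ S, |G w| ≤ M * (u₀ (w 0) * u₁ (w 1))) : IntegrableOn G S := by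
  have hdom : IntegrableOn (fun w : Fin 2 → ℝ => M * (u₀ (w 0) * u₁ (w 1))) S :=
    ((soloInformedDR_integrable_prod h₀ h₁).const_mul M).integrableOn
  refine Integrable.mono' hdom hG ?_
  filter_upwards [ae_restrict_mem hS] with w hw
  rw [Real.norm_eq_abs]
  exact hle w hw

/-- **The bound on the fibre derivative.**  If `|f| ≤ Mφ`, `|f'| ≤ Mφ'` at `x₂ = w 1`,
`|w 0 − w 1| ≥ ε > 0` and `f(w 0), f(w 1) ≠ 0`, then
`|∂A(w)| ≤ (Mφ'/(2ε) + Mφ/ε²)·Y(w 0)⁻¹·Y(w 1)⁻¹`. [this work] -/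
theorem soloInformedDR_der_bound (f : ℚ[X]) {ε Mφ Mφ' : ℝ} (hε : 0 < ε) (hMφ : 0 ≤ Mφ)
    (hMφ' : 0 ≤ Mφ') (w : Fin 2 → ℝ) (hsep : ε ≤ |w 0 - w 1|) (hb : |aeval (w 1) f| ≤ Mφ)
    (hb' : |aeval (w 1) (derivative f)| ≤ Mφ') (h0 : aeval (w 0) f ≠ 0) (h1 : aeval (w 1) f ≠ 0) :
    |soloInformedDRDer f w| ≤
      (Mφ' / (2 * ε) + Mφ / ε ^ 2) * ((√|aeval (w 0) f|)⁻¹ * (√|aeval (w 1) f|)⁻¹) := by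
  set D := w 0 - w 1 with hDdef
  have hY0 : 0 < √|aeval (w 0) f| := Real.sqrt_pos.2 (abs_pos.2 h0)
  have hY1 : 0 < √|aeval (w 1) f| := Real.sqrt_pos.2 (abs_pos.2 h1)
  have hDpos : 0 < |D| := hε.trans_le hsep
  have hD2 : 0 < D ^ 2 := by rw [← sq_abs]; positivity
  have hk1 : |D| ≤ D ^ 2 / ε := by
    rw [le_div_iff₀ hε]
    calc |D| * ε ≤ |D| * |D| := mul_le_mul_of_nonneg_left hsep (abs_nonneg _)
      _ = D ^ 2 := by rw [← sq, sq_abs]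
  have hk2 : (1:ℝ) ≤ D ^ 2 / ε ^ 2 := by
    rw [le_div_iff₀ (by positivity), one_mul]
    calc ε ^ 2 ≤ |D| ^ 2 := pow_le_pow_left₀ hε.le hsep 2
      _ = D ^ 2 := sq_abs D
  have hnum : |aeval (w 1) (derivative f) / 2 * D + aeval (w 1) f| ≤
      (Mφ' / (2 * ε) + Mφ / ε ^ 2) * D ^ 2 := by
    calc |aeval (w 1) (derivative f) / 2 * D + aeval (w 1) f|
        ≤ |aeval (w 1) (derivative f) / 2 * D| + |aeval (w 1) f| := abs_add_le _ _
      _ = |aeval (w 1) (derivative f)| / 2 * |D| + |aeval (w 1) f| := by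
          rw [abs_mul, abs_div, abs_two]
      _ ≤ Mφ' / 2 * (D ^ 2 / ε) + Mφ * (D ^ 2 / ε ^ 2) := by
          gcongr
          · calc |aeval (w 1) f| = |aeval (w 1) f| * 1 := (mul_one _).symm
              _ ≤ Mφ * (D ^ 2 / ε ^ 2) := by gcongr
      _ = (Mφ' / (2 * ε) + Mφ / ε ^ 2) * D ^ 2 := by ring
  have hden : 0 < D ^ 2 * √|aeval (w 0) f| * √|aeval (w 1) f| := by positivity
  rw [soloInformedDRDer, soloInformedDRY, soloInformedDRY, ← hDdef, abs_div, abs_of_pos hden,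
    div_le_iff₀ hden]
  calc |aeval (w 1) (derivative f) / 2 * D + aeval (w 1) f|
      ≤ (Mφ' / (2 * ε) + Mφ / ε ^ 2) * D ^ 2 := hnum
    _ = (Mφ' / (2 * ε) + Mφ / ε ^ 2) * ((√|aeval (w 0) f|)⁻¹ * (√|aeval (w 1) f|)⁻¹) *
          (D ^ 2 * √|aeval (w 0) f| * √|aeval (w 1) f|) := by
        field_simp

end Summit.KontsevichZagierPeriods.KontsevichZagierPeriods.Theorems

end
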